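import Mathlib
import Literature.Analysis.FluidPDE.VectorCalculus
import Summits.NavierStokesRegularity.NavierStokesRegularity.Theorems.FilamentSkeletonRssClause13RAdjointEnergy

/-!
# Clause 13-R, STUB R at MODEL level: the nonlocal term of the model adjoint equation for BOUNDED a.e.-measurable weights —
# sup bound, measurability, and the vanishing of its pairing (crux `Clause13RNearStraightL`, stmt-NavierStokesRegularity-23612;
# line `rate_bordered_split`, STUB R `stub_rateRow13RFlat`)

Route `FilamentSkeletonRss`, Variant A1R.  Toolkit for the improper energy identity of `…Clause13RAdjointPunctured` (census item (R-m1) of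
hand fsrs-19-g0): the nonlocal self-induction term `N σ = ∫_{τ∈S} k(τ−σ) • (φ τ × d) dτ` of the MODEL adjoint equation
(`…Clause13RAdjointStraightModelWeights`, `…Clause13RAdjointEnergy` p828845) for a weight `φ` that is only a.e.-strongly measurable and
BOUNDED on the ball `S = [a, b]` — the a-priori regularity of the density part of an annihilating measure, as opposed to the continuous
weights of p828845.  Results (7 thms): `aestronglyMeasurable_of_hasDerivAt_off` (differentiable off one station ⟹ a.e.-measurable on `S`),
`aestronglyMeasurable_nonlocal` / `norm_nonlocal_le_of_bounded` (measurability and the sup bound `‖N σ‖ ≤ K M‖d‖·|S|`), and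
`setIntegral_inner_nonlocal_eq_zero_of_bounded`: `∫_{σ∈S} ⟪N σ, φ σ⟫ dσ = 0` (antisymmetry of `k(τ−σ)⟪φ τ × d, φ σ⟫` under `σ ↔ τ` for an
even kernel, Fubini on the finite square) — the `L^∞` twin of p828845's `setIntegral_inner_nonlocal_eq_zero`.  [folklore]
Hand `leafhand-ns-filamentskeletonrs-19-g1` (LAND-ONLY); `--supports stmt-NavierStokesRegularity-23612` helper, def-free.  HONEST FRAMING:
measure-theoretic bookkeeping for the MODEL adjoint equation attached to a HYPOTHETICAL filament skeleton on the NEGATIVE side of a MODEL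
blow-up route; STUB R is NOT proved here and nothing in this file bears on Navier–Stokes regularity or blow-up.
-/
noncomputable section

open MeasureTheory Filter Topology Set intervalIntegral
open scoped RealInnerProductSpace InnerProductSpace
open Literature.Analysis.FluidPDE
open Summit.NavierStokesRegularity.NavierStokesRegularity.Theorems.Clause13RAdjointEnergy
  (inner_cross_left_swap nonlocal_density_antisymm)

namespace Summit.NavierStokesRegularity.NavierStokesRegularity.Theorems.Clause13RAdjointNonlocalBounded
set_option linter.dupNamespace false

/-! ## §1 Elementary bounds -/

/-- `x ↦ x × d` is continuous. [folklore] -/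
theorem continuous_cross_left (d : EuclideanSpace ℝ (Fin 3)) : Continuous fun x : EuclideanSpace ℝ (Fin 3) => cross x d := by
  have : Continuous fun x : EuclideanSpace ℝ (Fin 3) => crossCLM x d :=
    (crossCLM.continuous₂).comp₂ continuous_id continuous_const
  simpa only [crossCLM_apply] using this

/-- A continuous kernel is bounded on the difference set of the ball: `|k(τ − σ)| ≤ K` for `σ, τ ∈ [a, b]`. [folklore] -/
theorem kernel_bound_on_ball {a b : ℝ} {k : ℝ → ℝ} (hk : Continuous k) :
    ∃ K : ℝ, 0 ≤ K ∧ ∀ σ ∈ Icc a b, ∀ τ ∈ Icc a b, |k (τ - σ)| ≤ K := by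
  obtain ⟨K, hK⟩ := (isCompact_Icc (a := a - b) (b := b - a)).exists_bound_of_continuousOn hk.continuousOn
  refine ⟨max K 0, le_max_right _ _, fun σ hσ τ hτ => ?_⟩
  have hmem : τ - σ ∈ Icc (a - b) (b - a) := ⟨by linarith [hσ.2, hτ.1], by linarith [hσ.1, hτ.2]⟩
  have := hK _ hmem
  rw [Real.norm_eq_abs] at this
  exact this.trans (le_max_left _ _)

/-! ## §2 A weight that is continuous off the waist station is a.e.-strongly measurable on the ball -/

/-- A function differentiable on `[a, b] ∖ {c}` is a.e.-strongly measurable on `[a, b]`. [folklore] -/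
theorem aestronglyMeasurable_of_hasDerivAt_off {a b c : ℝ} {φ φ' : ℝ → EuclideanSpace ℝ (Fin 3)}
    (hφ : ∀ σ ∈ Icc a b, σ ≠ c → HasDerivAt φ (φ' σ) σ) :
    AEStronglyMeasurable φ (volume.restrict (Icc a b)) := by
  have hcont : ContinuousOn φ (Icc a b \ {c}) := fun σ hσ =>
    (hφ σ hσ.1 hσ.2).continuousAt.continuousWithinAt
  have hmeas : AEStronglyMeasurable φ (volume.restrict (Icc a b \ {c})) :=
    hcont.aestronglyMeasurable (measurableSet_Icc.diff (measurableSet_singleton c))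
  have hset : (Icc a b \ {c} : Set ℝ) =ᵐ[volume] (Icc a b : Set ℝ) :=
    sdiff_null_ae_eq_self (Real.volume_singleton (a := c))
  rwa [Measure.restrict_congr_set hset] at hmeas

/-! ## §3 The nonlocal term: bound, measurability, and the vanishing of its pairing (bounded weights) -/

/-- The nonlocal density `(σ, τ) ↦ k(τ − σ) • (φ τ × d)` is a.e.-strongly measurable on `S × S`. [folklore] -/
theorem aestronglyMeasurable_nonlocal_density {a b : ℝ} {k : ℝ → ℝ} (hk : Continuous k)
    {φ : ℝ → EuclideanSpace ℝ (Fin 3)} (hφm : AEStronglyMeasurable φ (volume.restrict (Icc a b)))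
    (d : EuclideanSpace ℝ (Fin 3)) :
    AEStronglyMeasurable (Function.uncurry fun σ τ : ℝ => k (τ - σ) • cross (φ τ) d)
      ((volume.restrict (Icc a b)).prod (volume.restrict (Icc a b))) := by
  have h1 : AEStronglyMeasurable (fun z : ℝ × ℝ => k (z.2 - z.1))
      ((volume.restrict (Icc a b)).prod (volume.restrict (Icc a b))) :=
    (hk.comp (continuous_snd.sub continuous_fst)).aestronglyMeasurable
  have h2 : AEStronglyMeasurable (fun z : ℝ × ℝ => cross (φ z.2) d)
      ((volume.restrict (Icc a b)).prod (volume.restrict (Icc a b))) :=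
    (continuous_cross_left d).comp_aestronglyMeasurable hφm.comp_snd
  exact h1.smul h2

/-- The nonlocal term `N σ = ∫_{τ∈S} k(τ−σ) • (φ τ × d)` is a.e.-strongly measurable on `S`. [folklore] -/
theorem aestronglyMeasurable_nonlocal {a b : ℝ} {k : ℝ → ℝ} (hk : Continuous k)
    {φ : ℝ → EuclideanSpace ℝ (Fin 3)} (hφm : AEStronglyMeasurable φ (volume.restrict (Icc a b)))
    (d : EuclideanSpace ℝ (Fin 3)) :
    AEStronglyMeasurable (fun σ => ∫ τ in Icc a b, k (τ - σ) • cross (φ τ) d) (volume.restrict (Icc a b)) :=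
  (aestronglyMeasurable_nonlocal_density hk hφm d).integral_prod_right'

/-- Sup bound for the nonlocal term of a BOUNDED weight: `‖N σ‖ ≤ K M ‖d‖ · |S|` on `S`. [folklore] -/
theorem norm_nonlocal_le_of_bounded {a b K M : ℝ} {k : ℝ → ℝ}
    (hK : ∀ σ ∈ Icc a b, ∀ τ ∈ Icc a b, |k (τ - σ)| ≤ K) (hK0 : 0 ≤ K)
    {φ : ℝ → EuclideanSpace ℝ (Fin 3)} (hM : ∀ τ ∈ Icc a b, ‖φ τ‖ ≤ M) (d : EuclideanSpace ℝ (Fin 3))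
    {σ : ℝ} (hσ : σ ∈ Icc a b) :
    ‖∫ τ in Icc a b, k (τ - σ) • cross (φ τ) d‖ ≤ K * (M * ‖d‖) * volume.real (Icc a b) := by
  -- `‖x × d‖ ≤ ‖x‖‖d‖` (the landed `Literature…norm_cross_le_norm_mul_norm`, re-derived to keep the imports light)
  have hcx : ∀ x : EuclideanSpace ℝ (Fin 3), ‖cross x d‖ ≤ ‖x‖ * ‖d‖ := fun x => by
    rw [norm_cross]; nlinarith [Real.sin_le_one (InnerProductGeometry.angle x d), mul_nonneg (norm_nonneg x) (norm_nonneg d)]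
  refine norm_setIntegral_le_of_norm_le_const measure_Icc_lt_top fun τ hτ => ?_
  rw [norm_smul, Real.norm_eq_abs]
  exact mul_le_mul (hK σ hσ τ hτ) ((hcx _).trans
    (mul_le_mul_of_nonneg_right (hM τ hτ) (norm_nonneg _))) (norm_nonneg _) hK0

/-- **The nonlocal term pairs to zero — bounded a.e.-measurable weights.**  For a continuous even kernel `k` and a weight `φ` that is
a.e.-strongly measurable and bounded on `S = [a, b]`, `∫_{σ∈S} ⟪∫_{τ∈S} k(τ−σ) • (φ τ × d) dτ, φ σ⟫ dσ = 0` (antisymmetry of the density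
`k(τ−σ)⟪φ τ × d, φ σ⟫` under `σ ↔ τ`, Fubini on the finite square).  The `L^∞` twin of `…Clause13RAdjointEnergy.setIntegral_inner_nonlocal_eq_zero`
(continuous weights). [folklore] -/
theorem setIntegral_inner_nonlocal_eq_zero_of_bounded {a b : ℝ} (hab : a ≤ b) {k : ℝ → ℝ} (hk : Continuous k)
    (hkev : ∀ s, k (-s) = k s) {φ : ℝ → EuclideanSpace ℝ (Fin 3)}
    (hφm : AEStronglyMeasurable φ (volume.restrict (Icc a b))) {M : ℝ} (hM : ∀ τ ∈ Icc a b, ‖φ τ‖ ≤ M)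
    (d : EuclideanSpace ℝ (Fin 3)) :
    ∫ σ in Icc a b, ⟪∫ τ in Icc a b, k (τ - σ) • cross (φ τ) d, φ σ⟫ = 0 := by
  set F : ℝ → ℝ → ℝ := fun σ τ => k (τ - σ) * ⟪cross (φ τ) d, φ σ⟫ with hF
  have hcx : ∀ x : EuclideanSpace ℝ (Fin 3), ‖cross x d‖ ≤ ‖x‖ * ‖d‖ := fun x => by
    rw [norm_cross]; nlinarith [Real.sin_le_one (InnerProductGeometry.angle x d), mul_nonneg (norm_nonneg x) (norm_nonneg d)]
  obtain ⟨K, hK0, hK⟩ := kernel_bound_on_ball (a := a) (b := b) hk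
  have hM0 : 0 ≤ M := (norm_nonneg _).trans (hM a ⟨le_rfl, hab⟩)
  -- measurability of the density on the square
  have hφ1 : AEStronglyMeasurable (fun z : ℝ × ℝ => φ z.1)
      ((volume.restrict (Icc a b)).prod (volume.restrict (Icc a b))) := hφm.comp_fst
  have hφ2 : AEStronglyMeasurable (fun z : ℝ × ℝ => cross (φ z.2) d)
      ((volume.restrict (Icc a b)).prod (volume.restrict (Icc a b))) :=
    (continuous_cross_left d).comp_aestronglyMeasurable hφm.comp_snd
  have hFm : AEStronglyMeasurable (Function.uncurry F)
      ((volume.restrict (Icc a b)).prod (volume.restrict (Icc a b))) := by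
    have h1 : AEStronglyMeasurable (fun z : ℝ × ℝ => k (z.2 - z.1))
        ((volume.restrict (Icc a b)).prod (volume.restrict (Icc a b))) :=
      (hk.comp (continuous_snd.sub continuous_fst)).aestronglyMeasurable
    exact h1.mul (hφ2.inner hφ1)
  -- a.e. membership in the square
  have hS1 : ∀ᵐ z : ℝ × ℝ ∂((volume.restrict (Icc a b)).prod (volume.restrict (Icc a b))), z.1 ∈ Icc a b :=
    (Measure.quasiMeasurePreserving_fst (μ := volume.restrict (Icc a b))
      (ν := volume.restrict (Icc a b))).tendsto_ae.eventually (ae_restrict_mem measurableSet_Icc)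
  have hS2 : ∀ᵐ z : ℝ × ℝ ∂((volume.restrict (Icc a b)).prod (volume.restrict (Icc a b))), z.2 ∈ Icc a b :=
    (Measure.quasiMeasurePreserving_snd (μ := volume.restrict (Icc a b))
      (ν := volume.restrict (Icc a b))).tendsto_ae.eventually (ae_restrict_mem measurableSet_Icc)
  -- integrability on the square (bounded density, finite measure)
  have hprod : Integrable (Function.uncurry F) ((volume.restrict (Icc a b)).prod (volume.restrict (Icc a b))) := by
    refine Integrable.mono' (integrable_const (K * ((M * ‖d‖) * M))) hFm ?_
    filter_upwards [hS1, hS2] with z hz1 hz2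
    simp only [Function.uncurry, hF, norm_mul, Real.norm_eq_abs]
    have hin : |⟪cross (φ z.2) d, φ z.1⟫| ≤ (M * ‖d‖) * M :=
      (abs_real_inner_le_norm _ _).trans (mul_le_mul ((hcx _).trans
        (mul_le_mul_of_nonneg_right (hM _ hz2) (norm_nonneg _))) (hM _ hz1) (norm_nonneg _) (by positivity))
    exact mul_le_mul (hK _ hz1 _ hz2) hin (abs_nonneg _) hK0
  -- Step 1: pull `φ σ` into the inner integral
  have hinner : ∀ σ ∈ Icc a b, ⟪∫ τ in Icc a b, k (τ - σ) • cross (φ τ) d, φ σ⟫ = ∫ τ in Icc a b, F σ τ := by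
    intro σ hσ
    have hmeas : AEStronglyMeasurable (fun τ => k (τ - σ) • cross (φ τ) d) (volume.restrict (Icc a b)) :=
      ((hk.comp (continuous_id.sub continuous_const)).aestronglyMeasurable).smul
        ((continuous_cross_left d).comp_aestronglyMeasurable hφm)
    have hint : IntegrableOn (fun τ => k (τ - σ) • cross (φ τ) d) (Icc a b) := by
      refine Integrable.mono' (integrable_const (K * (M * ‖d‖))) hmeas ?_
      filter_upwards [ae_restrict_mem measurableSet_Icc] with τ hτ
      rw [norm_smul, Real.norm_eq_abs]
      exact mul_le_mul (hK σ hσ τ hτ) ((hcx _).trans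
        (mul_le_mul_of_nonneg_right (hM τ hτ) (norm_nonneg _))) (norm_nonneg _) hK0
    rw [real_inner_comm, ← integral_inner hint (φ σ)]
    refine integral_congr_ae (Eventually.of_forall fun τ => ?_)
    simp only [hF, inner_smul_right, real_inner_comm (φ σ)]
  rw [setIntegral_congr_fun measurableSet_Icc hinner]
  -- Step 2: Fubini on the square
  have hswap : ∫ σ in Icc a b, ∫ τ in Icc a b, F σ τ = ∫ τ in Icc a b, ∫ σ in Icc a b, F σ τ :=
    integral_integral_swap hprod
  -- Step 3: antisymmetry
  have hanti : ∫ τ in Icc a b, ∫ σ in Icc a b, F σ τ = -∫ τ in Icc a b, ∫ σ in Icc a b, F τ σ := by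
    rw [← MeasureTheory.integral_neg]
    refine integral_congr_ae (Eventually.of_forall fun τ => ?_)
    simp only
    rw [← MeasureTheory.integral_neg]
    refine integral_congr_ae (Eventually.of_forall fun σ => ?_)
    simp only [hF]
    exact nonlocal_density_antisymm hkev φ d σ τ
  have hself : ∫ σ in Icc a b, ∫ τ in Icc a b, F σ τ = -∫ σ in Icc a b, ∫ τ in Icc a b, F σ τ := hswap.trans hanti
  linarith

end Summit.NavierStokesRegularity.NavierStokesRegularity.Theorems.Clause13RAdjointNonlocalBounded

end
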